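import Literature.Geometry.Riemannian.MetricFlowFDistanceComm
import HarnessLib

/-!
# Correspondences between a family of metric flows and `𝔽`-convergence within a correspondence
# (Bamler 2023, §5.1 Def. 5.5, Def. 5.6; §6.1 Def. 6.1)

R. Bamler, *Compactness theory of the space of super Ricci flows*, Invent. Math. 233 (2023),
§5.1, Definition 5.5 (arXiv v3 Def. 105): *"Let `(𝒳^i)_{i ∈ ℐ}` be a family of metric flows
defined over `I^i`, indexed by an arbitrary set `ℐ`. A correspondence between these flows over
`I''` is a pair `ℭ = ((Z_t, d^Z_t)_{t ∈ I''}, (φ^i_t)_{t ∈ I''^{,i}, i ∈ ℐ})` of metric spaces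
`(Z_t, d^Z_t)`, subsets `I''^{,i} ⊂ I^i ∩ I''` and isometric embeddings
`φ^i_t : (𝒳^i_t, d^i_t) → (Z_t, d^Z_t)`; it is fully defined over `J ⊂ I''` if `J ⊂ I''^{,i}`
for all `i`"*. The tree's `MetricFlow.Correspondence₂` (`MetricFlowFDistance.lean`) is the case
`ℐ = {1, 2}`, over which the `𝔽`-distance within a correspondence `d_𝔽^{ℭ,J}` (Def. 5.6, arXiv
Def. 106) and the `𝔽`-distance `d_𝔽^J` are defined (`MetricFlowPair.fDistWithin`,
`MetricFlowPair.fDist`). §5.2 (Prop. 5.14), §6 (Def. 6.1: `𝔽`-convergence of a sequence within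
ONE correspondence between all `𝒳^i`, `i ∈ ℕ ∪ {∞}`) and §7 need more than two flows in one
correspondence. This DEFINITION file provides:

* `MetricFlow.FamilyCorrespondence 𝒳 I''` (the name `MetricFlow.Correspondence` is taken by an
  older two-flow structure of `RicciFlowThroughSingularitiesFour.lean`) — Def. 5.5 for a family
  `𝒳 : ∀ i, MetricFlow (I i)` over an
  arbitrary index type `ι` (comparison METRIC spaces `Z_t` with their Borel σ-algebras, domains
  `dom i ⊆ I i ∩ I''`, isometric embeddings `φ i t`), `FamilyCorrespondence.FullyDefinedOver`,
  `dom_subset_left/right`;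
* `MetricFlow.FamilyCorrespondence.pair ℭ i j : Correspondence₂ (𝒳 i) (𝒳 j) I''` — the restriction
  to
  two indices (all fields by projection), with `pair_swap : (ℭ.pair i j).swap = ℭ.pair j i` (`rfl`)
  and `FullyDefinedOver.pair`; conversely `MetricFlow.Correspondence₂.toFamilyCorrespondence` — a
  correspondence between two flows as a correspondence over the index type `Bool`
  (`true ↦ 𝒳¹`, `false ↦ 𝒳²`), with
  `toFamilyCorrespondence_pair : ℭ.toFamilyCorrespondence.pair true false = ℭ`;
* `MetricFlowPair.fDistWithinFamily P ℭ i j J := fDistWithin (P i) (P j) (ℭ.pair i j) J` — the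
  `𝔽`-distance within `ℭ` between two members of a family `P : ι → MetricFlowPair I₀` of metric
  flow pairs in a correspondence `ℭ` between their flows (Def. 5.6 applied to `ℭ.pair i j`), and
  the symmetry `fDistWithin_pair_comm` (from `MetricFlowPair.fDistWithin_swap`);
* `MetricFlowPair.FConvergesWithin P Pinf ℭ J` — **Def. 6.1** (arXiv Def. 124), the version
  "uniform over `J`": a sequence of metric flow pairs `P n`, `n ∈ ℕ`, `𝔽`-converges to `Pinf` within
  a correspondence `ℭ` between all the flows `(P n).flow`, `Pinf.flow` (indexed by `Option ℕ`,
  `none = ∞`), uniformly over `J`, iff `d_𝔽^{ℭ,J}(P n, Pinf) → 0`; and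
  `FConvergesWithin.fDist_tendsto`: then `d_𝔽^J(P n, Pinf) → 0` if `ℭ` is over `I₀` and the pairs
  `ℭ.pair n ∞` are fully defined over `J` (`fDist_le_fDistWithin`).

`MetricFlowFDistance.lean` is not modified. What is NOT here: the time-wise version of Def. 6.1
("on compact time-intervals"), convergence of conjugate heat flows / points within `ℭ` (§6.2),
and the gluing of correspondences (Prop. 5.14).

## References

* R. H. Bamler, *Compactness theory of the space of super Ricci flows*, Invent. Math. 233 (2023),
  1121–1277 (arXiv:2008.09298), §5.1, Def. 5.5 (Correspondence), Def. 5.6 (`𝔽`-distance within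
  correspondence), Def. 5.8 (`𝔽`-distance); §6.1, Def. 6.1 (`𝔽`-convergence within
  correspondence). [Bamler2023]
-/

noncomputable section

open Set MeasureTheory Filter TopologicalSpace Function
open scoped Topology ENNReal NNReal

namespace Literature.Geometry.Riemannian

universe u v

/-! ### Def. 5.5: correspondences between a family of metric flows -/

namespace MetricFlow

/-- **Correspondence between a family of metric flows `𝒳^i` (over `I^i`), `i ∈ ℐ`, over
`I'' ⊆ ℝ`**
(Bamler 2023, §5.1, Def. 5.5 / arXiv v3 Def. 105): comparison metric spaces `(Z_t, d^Z_t)`,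
`t ∈ I''` (with their Borel σ-algebras; the source's `Z_t` are metric spaces, no completeness or
separability is required), domains `I''^{,i} ⊆ I^i ∩ I''`, and isometric embeddings
`φ^i_t : 𝒳^i_t → Z_t` for `t ∈ I''^{,i}`. The index type `ι` is arbitrary; the case
`ℐ = {1, 2}` is `MetricFlow.Correspondence₂` (see `FamilyCorrespondence.pair`,
`Correspondence₂.toFamilyCorrespondence`). [cite: Bamler2023, §5.1, Def. 5.5 (Correspondence)] -/
structure FamilyCorrespondence {ι : Type v} {I : ι → Set ℝ} (𝒳 : ∀ i, MetricFlow.{u} (I i))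
    (I'' : Set ℝ) : Type (max (u + 1) v) where
  /-- The comparison space `Z_t`, `t ∈ I''`. -/
  Z : I'' → Type u
  /-- `(Z_t, d^Z_t)` is a metric space … -/
  [instMetricSpace : ∀ t, MetricSpace (Z t)]
  /-- … with a σ-algebra … -/
  [instMeasurableSpace : ∀ t, MeasurableSpace (Z t)]
  /-- … equal to its Borel σ-algebra. -/
  [instBorelSpace : ∀ t, BorelSpace (Z t)]
  /-- The domains `I''^{,i}` of the embeddings. -/
  dom : ι → Set ℝ
  /-- `I''^{,i} ⊆ I^i ∩ I''`. -/
  dom_subset : ∀ i, dom i ⊆ I i ∩ I''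
  /-- The embeddings `φ^i_t : 𝒳^i_t → Z_t`, `t ∈ I''^{,i}`. -/
  φ : ∀ (i : ι) (t : ℝ) (ht : t ∈ dom i),
    (𝒳 i).Slice ⟨t, (dom_subset i ht).1⟩ → Z ⟨t, (dom_subset i ht).2⟩
  /-- `φ^i_t` is an isometric embedding. -/
  isometry : ∀ i t ht, Isometry (φ i t ht)

attribute [instance] FamilyCorrespondence.instMetricSpace FamilyCorrespondence.instMeasurableSpace
  FamilyCorrespondence.instBorelSpace

namespace FamilyCorrespondence

variable {ι : Type v} {I : ι → Set ℝ} {𝒳 : ∀ i, MetricFlow.{u} (I i)} {I'' : Set ℝ}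

/-- **`ℭ` is fully defined over `J`**: `J ⊆ I''^{,i}` for all `i ∈ ℐ` (Bamler 2023, §5.1,
Def. 5.5: "If `J ⊂ I''^{,i}` for all `i ∈ ℐ`, then we say that `ℭ` is fully defined over `J`").
[cite: Bamler2023, §5.1, Def. 5.5 (Correspondence)] -/
def FullyDefinedOver (ℭ : FamilyCorrespondence 𝒳 I'') (J : Set ℝ) : Prop :=
  ∀ i, J ⊆ ℭ.dom i

/-- The domains of a correspondence lie in `I''`.
[cite: Bamler2023, §5.1, Def. 5.5 (Correspondence)] -/
theorem dom_subset_right (ℭ : FamilyCorrespondence 𝒳 I'') (i : ι) : ℭ.dom i ⊆ I'' :=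
  fun _ ht ↦ (ℭ.dom_subset i ht).2

/-- The domains of a correspondence lie in the time-sets of the flows.
[cite: Bamler2023, §5.1, Def. 5.5 (Correspondence)] -/
theorem dom_subset_left (ℭ : FamilyCorrespondence 𝒳 I'') (i : ι) : ℭ.dom i ⊆ I i :=
  fun _ ht ↦ (ℭ.dom_subset i ht).1

/-- A correspondence fully defined over `J` is fully defined over every `J' ⊆ J`.
[cite: Bamler2023, §5.1, Def. 5.5 (Correspondence)] -/
theorem FullyDefinedOver.mono {ℭ : FamilyCorrespondence 𝒳 I''} {J J' : Set ℝ}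
    (h : ℭ.FullyDefinedOver J)
    (hJ' : J' ⊆ J) : ℭ.FullyDefinedOver J' :=
  fun i ↦ hJ'.trans (h i)

/-- If `ℭ` is fully defined over `J` then `J ⊆ I''`.
[cite: Bamler2023, §5.1, Def. 5.5 (Correspondence)] -/
theorem FullyDefinedOver.subset {ℭ : FamilyCorrespondence 𝒳 I''} {J : Set ℝ}
    (h : ℭ.FullyDefinedOver J)
    (i : ι) : J ⊆ I'' :=
  (h i).trans (ℭ.dom_subset_right i)

/-! ### Restriction to two indices -/

/-- **The correspondence between `𝒳^i` and `𝒳^j` induced by a correspondence between the whole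
family** (Bamler 2023, §5.1, Def. 5.5 restricted to `ℐ' = {i, j} ⊆ ℐ`): the same comparison
spaces, the two domains `I''^{,i}`, `I''^{,j}` and the two families of embeddings.
[cite: Bamler2023, §5.1, Def. 5.5 (Correspondence)] -/
@[reducible] def pair (ℭ : FamilyCorrespondence 𝒳 I'') (i j : ι) :
    Correspondence₂ (𝒳 i) (𝒳 j) I'' where
  Z := ℭ.Z
  dom₁ := ℭ.dom i
  dom₂ := ℭ.dom j
  dom₁_subset := ℭ.dom_subset i
  dom₂_subset := ℭ.dom_subset j
  φ₁ := ℭ.φ i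
  φ₂ := ℭ.φ j
  isometry₁ := ℭ.isometry i
  isometry₂ := ℭ.isometry j

/-- Exchanging the two indices swaps the induced correspondence.
[cite: Bamler2023, §5.1, Def. 5.5 (Correspondence)] -/
@[simp] theorem pair_swap (ℭ : FamilyCorrespondence 𝒳 I'') (i j : ι) :
    (ℭ.pair i j).swap = ℭ.pair j i :=
  rfl

/-- The comparison spaces of `ℭ.pair i j` are those of `ℭ`.
[cite: Bamler2023, §5.1, Def. 5.5 (Correspondence)] -/
@[simp] theorem pair_Z (ℭ : FamilyCorrespondence 𝒳 I'') (i j : ι) : (ℭ.pair i j).Z = ℭ.Z := rfl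

/-- The first domain of `ℭ.pair i j` is `I''^{,i}`.
[cite: Bamler2023, §5.1, Def. 5.5 (Correspondence)] -/
@[simp] theorem pair_dom₁ (ℭ : FamilyCorrespondence 𝒳 I'') (i j : ι) :
    (ℭ.pair i j).dom₁ = ℭ.dom i := rfl

/-- The second domain of `ℭ.pair i j` is `I''^{,j}`.
[cite: Bamler2023, §5.1, Def. 5.5 (Correspondence)] -/
@[simp] theorem pair_dom₂ (ℭ : FamilyCorrespondence 𝒳 I'') (i j : ι) :
    (ℭ.pair i j).dom₂ = ℭ.dom j := rfl

/-- A correspondence fully defined over `J` induces pair correspondences fully defined over `J`.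
[cite: Bamler2023, §5.1, Def. 5.5 (Correspondence)] -/
theorem FullyDefinedOver.pair {ℭ : FamilyCorrespondence 𝒳 I''} {J : Set ℝ}
    (h : ℭ.FullyDefinedOver J)
    (i j : ι) : (ℭ.pair i j).FullyDefinedOver J :=
  ⟨h i, h j⟩

/-- `ℭ` is fully defined over `J` iff all induced pair correspondences are.
[cite: Bamler2023, §5.1, Def. 5.5 (Correspondence)] -/
theorem fullyDefinedOver_iff_pair (ℭ : FamilyCorrespondence 𝒳 I'') (J : Set ℝ) :
    ℭ.FullyDefinedOver J ↔ ∀ i j, (ℭ.pair i j).FullyDefinedOver J :=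
  ⟨fun h i j ↦ h.pair i j, fun h i ↦ (h i i).1⟩

end FamilyCorrespondence

/-! ### A correspondence between two flows as a correspondence over `Bool` -/

namespace Correspondence₂

variable {I₁ I₂ : Set ℝ} {𝒳₁ : MetricFlow.{u} I₁} {𝒳₂ : MetricFlow.{u} I₂} {I'' : Set ℝ}

/-- The time-sets of the `Bool`-indexed family `true ↦ I¹`, `false ↦ I²`.
[cite: Bamler2023, §5.1, Def. 5.5 (Correspondence)] -/
@[reducible] def boolTimes (I₁ I₂ : Set ℝ) : Bool → Set ℝ := fun b ↦ cond b I₁ I₂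

/-- The `Bool`-indexed family of flows `true ↦ 𝒳¹`, `false ↦ 𝒳²`.
[cite: Bamler2023, §5.1, Def. 5.5 (Correspondence)] -/
@[reducible] def boolFlows (𝒳₁ : MetricFlow.{u} I₁) (𝒳₂ : MetricFlow.{u} I₂) :
    ∀ b : Bool, MetricFlow.{u} (boolTimes I₁ I₂ b)
  | true => 𝒳₁
  | false => 𝒳₂

/-- **A correspondence between two metric flows is a correspondence over the index set
`{1, 2} ≅ Bool`** (`true ↦ 𝒳¹`, `false ↦ 𝒳²`): the same comparison spaces, domains and
embeddings (Bamler 2023, §5.1, Def. 5.5 with `ℐ = {1, 2}`).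
[cite: Bamler2023, §5.1, Def. 5.5 (Correspondence)] -/
def toFamilyCorrespondence (ℭ : Correspondence₂ 𝒳₁ 𝒳₂ I'') :
    FamilyCorrespondence (boolFlows 𝒳₁ 𝒳₂) I'' where
  Z := ℭ.Z
  dom := fun b ↦ cond b ℭ.dom₁ ℭ.dom₂
  dom_subset := fun b ↦ match b with
    | true => ℭ.dom₁_subset
    | false => ℭ.dom₂_subset
  φ := fun b ↦ match b with
    | true => ℭ.φ₁
    | false => ℭ.φ₂
  isometry := fun b ↦ match b with
    | true => ℭ.isometry₁
    | false => ℭ.isometry₂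

/-- Restricting the `Bool`-indexed correspondence of `ℭ` to `(true, false)` gives back `ℭ`.
[cite: Bamler2023, §5.1, Def. 5.5 (Correspondence)] -/
theorem toFamilyCorrespondence_pair (ℭ : Correspondence₂ 𝒳₁ 𝒳₂ I'') :
    ℭ.toFamilyCorrespondence.pair true false = ℭ := rfl

/-- `ℭ.toFamilyCorrespondence` is fully defined over `J` iff `ℭ` is.
[cite: Bamler2023, §5.1, Def. 5.5 (Correspondence)] -/
theorem fullyDefinedOver_toFamilyCorrespondence (ℭ : Correspondence₂ 𝒳₁ 𝒳₂ I'') (J : Set ℝ) :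
    ℭ.toFamilyCorrespondence.FullyDefinedOver J ↔ ℭ.FullyDefinedOver J :=
  ⟨fun h ↦ ⟨h true, h false⟩, fun h b ↦ match b with
    | true => h.1
    | false => h.2⟩

end Correspondence₂

end MetricFlow

/-! ### Def. 5.6 for two members of a family; Def. 6.1 -/

namespace MetricFlowPair

open MetricFlow

variable {ι : Type v} {I₀ I'' : Set ℝ}

/-- **The `𝔽`-distance within a correspondence between two members of a family of metric flow
pairs**, uniform over `J` (Bamler 2023, §5.1, Def. 5.6 / arXiv v3 Def. 106, "the `𝔽`-distance
between two metric flow pairs … within `ℭ` (where `j, k ∈ ℐ`)"): for `P : ι → MetricFlowPair I₀`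
and a correspondence `ℭ` between the flows `(P i).flow`, `d_𝔽^{ℭ,J}(P i, P j)` is the
`𝔽`-distance within the induced correspondence `ℭ.pair i j`.
[cite: Bamler2023, §5.1, Def. 5.6 (F-distance within correspondence)] -/
abbrev fDistWithinFamily (P : ι → MetricFlowPair.{u} I₀)
    (ℭ : FamilyCorrespondence (fun i ↦ (P i).flow) I'') (i j : ι) (J : Set ℝ) : ℝ≥0∞ :=
  fDistWithin (P i) (P j) (ℭ.pair i j) J

/-- **`𝔽`-convergence within a correspondence, uniform over `J`** (Bamler 2023, §6.1, Def. 6.1 /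
arXiv v3 Def. 124: "We say that the metric flow pairs `(𝒳^i, (μ^i_t))` `𝔽`-converge to
`(𝒳^∞, (μ^∞_t))` within `ℭ` and uniformly over `J` if …
`d_𝔽^{ℭ,J}((𝒳^i, (μ^i_t)), (𝒳^∞, (μ^∞_t))) → 0`"):
for a sequence `P : ℕ → MetricFlowPair I₀`, a limit `Pinf` (`= P∞`) and a correspondence `ℭ`
between all the flows, indexed by `Option ℕ` (`some n ↦ (P n).flow`, `none ↦ Pinf.flow`), the
`𝔽`-distances within the induced pair correspondences `ℭ.pair (some n) none` tend to `0`.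
[cite: Bamler2023, §6.1, Def. 6.1 (F-convergence within correspondence)] -/
def FConvergesWithin (P : ℕ → MetricFlowPair.{u} I₀) (Pinf : MetricFlowPair.{u} I₀)
    (ℭ : FamilyCorrespondence (fun o : Option ℕ ↦ (o.elim Pinf P).flow) I'') (J : Set ℝ) : Prop :=
  Tendsto (fun n ↦ fDistWithin (P n) Pinf (ℭ.pair (some n) none) J) atTop (𝓝 0)

/-- **`𝔽`-convergence within a correspondence over `I₀` fully defined over `J` implies
`𝔽`-convergence uniformly over `J`**: `d_𝔽^J(P n, P∞) ≤ d_𝔽^{ℭ_n,J}(P n, P∞) → 0` for the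
induced
pair correspondences `ℭ_n = ℭ.pair n ∞` (Bamler 2023, §5.1, Def. 5.8: `d_𝔽^J` is the infimum over
correspondences over `I₀` fully defined over `J`).
[cite: Bamler2023, §6.1, Def. 6.1 (F-convergence within correspondence)] -/
theorem FConvergesWithin.fDist_tendsto {P : ℕ → MetricFlowPair.{u} I₀}
    {Pinf : MetricFlowPair.{u} I₀}
    {ℭ : FamilyCorrespondence (fun o : Option ℕ ↦ (o.elim Pinf P).flow) I₀} {J : Set ℝ}
    (h : FConvergesWithin P Pinf ℭ J) (hJ : ∀ n, (ℭ.pair (some n) none).FullyDefinedOver J) :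
    Tendsto (fun n ↦ fDist J (P n) Pinf) atTop (𝓝 0) :=
  tendsto_of_tendsto_of_tendsto_of_le_of_le tendsto_const_nhds h (fun _ ↦ zero_le)
    fun n ↦ fDist_le_fDistWithin (P₁ := P n) (P₂ := Pinf) (ℭ.pair (some n) none) (hJ n)

/-- `𝔽`-convergence within a correspondence fully defined over `J` (as a correspondence of the
whole family) implies `𝔽`-convergence uniformly over `J`.
[cite: Bamler2023, §6.1, Def. 6.1 (F-convergence within correspondence)] -/
theorem FConvergesWithin.fDist_tendsto_of_fullyDefinedOver {P : ℕ → MetricFlowPair.{u} I₀}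
    {Pinf : MetricFlowPair.{u} I₀}
    {ℭ : FamilyCorrespondence (fun o : Option ℕ ↦ (o.elim Pinf P).flow) I₀}
    {J : Set ℝ} (h : FConvergesWithin P Pinf ℭ J) (hJ : ℭ.FullyDefinedOver J) :
    Tendsto (fun n ↦ fDist J (P n) Pinf) atTop (𝓝 0) :=
  h.fDist_tendsto fun n ↦ hJ.pair (some n) none

end MetricFlowPair

/-- **Symmetry of the `𝔽`-distance within a correspondence between two members of a family**
(Bamler 2023, §5.1, Def. 5.6: `d_𝔽^{ℭ,J}` is symmetric in the two indices, the defining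
conditions being symmetric): `d_𝔽^{ℭ.pair j i, J}(P j, P i) = d_𝔽^{ℭ.pair i j, J}(P i, P j)`, since
`ℭ.pair j i = (ℭ.pair i j).swap` and `MetricFlowPair.fDistWithin_swap`.
[cite: Bamler2023, §5.1, Def. 5.6 (F-distance within correspondence)] -/
theorem fDistWithin_pair_comm {ι : Type v} {I₀ I'' : Set ℝ} (P : ι → MetricFlowPair.{u} I₀)
    (ℭ : MetricFlow.FamilyCorrespondence (fun i ↦ (P i).flow) I'') (i j : ι) (J : Set ℝ) :
    MetricFlowPair.fDistWithin (P j) (P i) (ℭ.pair j i) J =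
      MetricFlowPair.fDistWithin (P i) (P j) (ℭ.pair i j) J :=
  MetricFlowPair.fDistWithin_swap (ℭ.pair i j) J

end Literature.Geometry.Riemannian

end
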